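import Summits.ResolutionOfSingularities.ResolutionOfSingularities.Theorems.FrobeniusClosingSteerHevLeafWords
import Literature.AlgebraicGeometry.Resolution.ExcellentRings
import Mathlib.RingTheory.AdicCompletion.Basic
import HarnessLib

/-!
# Crux `Steer` (stmt-ResolutionOfSingularities-16345), chain W4.1 — K-β7-HAT WORDS: the kernel decomposition of the repaired
# `FormalCentreDescent` (β-leaf binder hβ6′) — `IsHatOf` · `FormalCentreDescent` · F0 `HatFrame` · S0 `HatCoordinates` · W1 `BranchTransfer` ·
# W2 `BranchObstruction` · W3 `BranchConclusion` + the PROVED assembly `formalCentreDescent_of`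

OURS (campaign `res-hironaka`, rung L ★L-G4, slot W4.1). AUTHOR of the words and of the assembly: res-L0-w41-idea-1 g12 (β-leaf author),
`L/res-L0-w41-idea-1/K7HatWords-idea-1-g12.lean` **cbdb8a4f311bfcb9** (311 l.; farm rc 0 · 0 sorries), ordered by res-L0-w41-plan-1 RULINGS 206(d) /
207(c) / 209(b) / 214(d) / 237(b). FILED by res-D-pv-035 g8 on RULING 241(c) («pv-035 files the K7Hat WORDS FILE itself: the five Props + proved
`formalCentreDescent_of` + `branch_handover_shape`, verbatim»). CHANGES w.r.t. the source, all cosmetic: namespace `…Theorems.SwitchingDichotomy.K7Hat`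
(instead of `…Cruxes.Steer.Ideas1.K7Hat`); `NoSingularSurfaceAt` is NOT re-declared — it is the tree word `…SwitchingDichotomy.HevLeaf.NoSingularSurfaceAt`
(`…HevLeafWords` p545980, byte-identical body), `open`ed; bracket tags «[folklore]» respelled «(folklore)»; the W2 docstring cites res-D-lit-1ʼs tree theorem
`exists_branchParametrization_of_complete` (p554060). Every `def` body and both theorem bodies are BYTE-IDENTICAL to cbdb8a4f311bfcb9 (script-checked).
Everything here is OURS: candidate statements of this cell, NOT results of the manuscript under review [claim: Hironaka2017, status: under-review];
AI review is weaker than expert review; nothing is asserted as a fact except the kernel-checked assembly `formalCentreDescent_of` (and the interface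
check `branch_handover_shape`) at the bottom. HANDS (RULINGS 241(c) / 242(c)): W3 `branchConclusion_holds` res-D-pv-035 (kernel-closed draft
29d9dd4d2d139a77, files on this moduleʼs olean) · F0/S0 res-D-pv-035 next · W2 res-D-pv-036 · W1 res-L0-w41-idea-3.

## What this file is (idea-1ʼs text)

The word `FormalCentreDescent` (K-β6′, R-K7 guarded form with `Odd d`; leaf of record `Sketch-idea-1-v18-hatleaf.v184-J4K7SH.lean`
ace46a15f53b37fc l.688–701 = successor `…v184-J4K7SHCPT.lean` 023cf61a3c1b773d, binder hβ6′ of `hK4_of_betaHat`) is restated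
VERBATIM below together with its vocabulary word `IsHatOf` (and the tree word `NoSingularSurfaceAt`), and CUT into kernel pieces following the paper proof of
memo `CANONICAL-CLEANING-g10.md` 3f18684792150801 §12.3 (1)–(5) / §12.5 (a)–(g):

| piece | decl | memo step | size | status |
|---|---|---|---|---|
| F0 | `HatFrame` | frame: `IsHatOf ι` ⟹ `T ≃ (R i)^` over `R i` | S/M | support (proversʼ shared first move) |
| S0 | `HatCoordinates` | `T` regular of dim 4, `𝔪_T = (ιx, ιy, z′, w′)`, `P₁ = (ιx, z′, w′)` prime with `dim T/P₁ = 1` | S/M | support (not in the assembly) |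
| W1 | `BranchTransfer` | (1) `Q₀ := P₁ ∩ R i` is a singular CURVE, `Q₀T` radical, `P₁` a branch, all branches contract to `Q₀` with `dim 1`; (2) SQUARE DESCENT datum `u²F + r² ∈ Q₀^d`, `u ∉ Q₀` | M/L | crux piece |
| W2 | `BranchObstruction` | (3)+(4) a branch `𝔓 ≠ P₁` forces `Ψ̄ = ℓ^{d−1}·m` over the branch field — excluded for ODD anisotropic `Ψ̄` | L | crux piece (the heart) |
| W3 | `BranchConclusion` | (5) `Q₀T = P₁` ⟹ `R i/Q₀` regular ⟹ `Q₀ = (x, z″, w″)`, `z″ ≡ z`, `w″ ≡ w (mod (x, y))` | S/M | crux piece |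

and the PROVED assembly

  `theorem formalCentreDescent_of : HatFrame → BranchTransfer → BranchObstruction → BranchConclusion → FormalCentreDescent`

(pure logic + «a radical ideal with exactly one minimal prime equals it»: `Ideal.IsRadical.radical`, `Ideal.sInf_minimalPrimes`, `sInf_singleton`).

## Typing decisions (idea-1)

* The pieces keep `FormalCentreDescent`ʼs OWN ambient data (run `R : ℕ → Subring K`, radicand `F := ⟨s i ^ 2, hs⟩ : R i`, abstract hat
  `ι : R i →+* T` with `IsHatOf ι`) so that the assembly is `intro … ; exact …` with no transport. Because every tree input is phrased for
  `AdicCompletion (maximalIdeal A) A` (or for a complete regular local ring), each piece ALSO receives the FRAME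
  `e : T ≃+* AdicCompletion (maximalIdeal (R i)) (R i)` with `e ∘ ι = algebraMap` as a hypothesis; the assembly produces `e` once, from `HatFrame`.
* No symbolic powers, no localisations in the INTERFACES: the square-descent output of memo §12.3 (2), `F ∈ ((R i)_Q₀)^[2] + Q₀^d (R i)_Q₀`, is carried
  as `∃ u r : R i, u ∉ Q₀ ∧ u ^ 2 * F + r ^ 2 ∈ Q₀ ^ d` (clear denominators, multiply by a unit square; characteristic 2 turns `−r²` into `+r²`).
* The branch set is `(Q₀T).minimalPrimes` (`Q₀T := Ideal.map ι Q₀`); «`𝔓` is a formal branch of the curve `Q₀`» = `𝔓 ∈ (Q₀T).minimalPrimes`, and W1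
  hands W2 the two facts it needs about every branch: `𝔓 ∩ R i = Q₀` and `dim T/𝔓 = 1`.
* `IsHatRing` (the leafʼs §3 word) is NOT used: it binds `PerfectField (ResidueField S)`, while `FormalCentreDescent` is over an ARBITRARY residue
  field (the K7 analysis: the odd-`d` word holds over any `κ`; the even-`d` word fails exactly over imperfect `κ`). W2 therefore consumes the
  any-extension odd-`d` form `…SwitchingDichotomy.OddAnisotropic.OddAnisotropicNoAlmostPower` (p550085/p551405).
* Chain negatives honoured: the un-guarded even-`d` `FormalCentreDescent` (K7 witness `κ = 𝔽₂(a)`, `Ψ = Z² + aW²`) is NOT restated — every piece that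
  uses the cone carries `Odd d`; no `hNS`-style global binder; no `∂F ∈ R i` transfer for abstract `R i` (replaced by SQUARE DESCENT, tree
  `…SwitchingDichotomy.SquareDescent.squareDescent_holds` p551383).

## Kernel inputs BY NAME (res-L1-type-o6 FACT MAP f56333df364710dc + RULING 214(d); all `Literature.AlgebraicGeometry.Resolution.` unless qualified)

(a) singularity transfer / regular formal fibres: `IsExcellentRing.isQuasiExcellentRing`, `IsGRing.isRegularHom_adicCompletion`,
    `IsRegularHom.isRegularLocalRing_localization_quotient_map_under`, `IsRegularLocalRing.of_flat_ringHom` / `.of_flat_of_isLocalHom` (CRT 23.7 (i)),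
    `isRegularLocalRing_iff_of_flat_of_isRegularLocalRing_fibre` (CRT 23.7 (ii)), `IsRegularLocalRing.of_flat_of_map_maximalIdeal_eq`,
    `isRegularLocalRing_iff_of_flat_of_map_maximalIdeal_eq` / `ringKrullDim_eq_of_flat_of_map_maximalIdeal_eq`, tree `isSingPrime_of_add_sq_mem_sq`;
(b) analytic unramifiedness: `IsGRing.isRadical_map_adicCompletion`, `IsGRing.isReduced_adicCompletion` (CRT 32.2), `IsExcellentRing.of_surjective`,
    `IsGRing.map_adicCompletion_eq_of_forall_minimalPrimes`;
(c) heights / going down: `ringKrullDim_eq_add_of_flat` (CRT 15.1), `under_eq_of_mem_minimalPrimes_map` / `Ideal.under_eq_of_mem_minimalPrimes_map`,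
    `Literature.RingTheory.HilbertSamuel.…under_mem_minimalPrimes_of_hasGoingDown`, Mathlib `AdicCompletion.flat_of_isNoetherian`;
(d) Cohen coordinates (RULING 214(d)): `exists_ringEquiv_mvPowerSeries_residueField` ([Matsumura 29.7]), `exists_ringEquiv_adicCompletion_mvPowerSeries_of_rsop`,
    engine `comp_map_bijective`; `isRegularLocalRing_adicCompletion`; `Literature.RingTheory.CompleteLocalRings.exists_ringHom_comp_residue_eq_id_of_subring`;
(e) the algebra of the heart: `…SwitchingDichotomy.TranslationInvariant.eq_C_mul_linearPow_of_translation_invariant` (p550845),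
    `…SwitchingDichotomy.OddAnisotropic.oddAnisotropicNoAlmostPower_holds` (p551405), Mathlib `Polynomial.hasseDeriv`, and the branch parametrisation
    `exists_branchParametrization_of_complete` (res-D-lit-1 p554060);
(f) square descent: `…SwitchingDichotomy.SquareDescent.squareDescent_holds` (p551383; its residue hypothesis «`L ∩ K^{1/2} = K`» is discharged from
    the geometric regularity of the formal fibre `κ(Q₀) → κ(P₁)`).

A prover who closes W1, W2, W3 (and the support F0) against THESE words has closed the leafʼs hβ6′: `IsHatOf`, `NoSingularSurfaceAt`, `FormalCentreDescent`
are character-identical to the leafʼs, so `(formalCentreDescent_of hF hT hO hC : BetaDebts.FormalCentreDescent)` elaborates by `δ`-unfolding.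
(folklore)
bears_on: LADDER-RESOLUTION L ★L-G4 W4.1 (crux `Steer`, β-leaf binder hβ6′).
-/

-- `Summit.<S>.<S>.…` duplicates the summit name by design (single-problem summit).
set_option linter.dupNamespace false
set_option autoImplicit false

open IsLocalRing

namespace Summit.ResolutionOfSingularities.ResolutionOfSingularities.Theorems.SwitchingDichotomy.K7Hat

open Literature.AlgebraicGeometry.Resolution
open Summit.ResolutionOfSingularities.ResolutionOfSingularities.Theorems.SwitchingDichotomy.Words
open Summit.ResolutionOfSingularities.ResolutionOfSingularities.Theorems.SwitchingDichotomy.HevLeaf (NoSingularSurfaceAt)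

/-! ## §0 The three words of the leaf: `NoSingularSurfaceAt` is the TREE word `…Theorems.SwitchingDichotomy.HevLeaf.NoSingularSurfaceAt`
(`…HevLeafWords`, p545980; byte-identical body, VERBATIM r42 l.4645) and is `open`ed above, NOT re-declared; `IsHatOf` and `FormalCentreDescent`
are VERBATIM from the leaf of record (ace46a15f53b37fc l.639 / l.688–701 = idea-1 cbdb8a4f311bfcb9 l.104 / l.111). -/

/-- VERBATIM (leaf §5♯): `ι : S →+* T` presents `T` as the `𝔪_S`-ADIC COMPLETION of the local ring `S` (elementary characterisation): `T` is
Noetherian, local, `𝔪_T`-adically complete, `𝔪_S T = 𝔪_T`, `ι(S)` is dense, and `𝔪_T^n ∩ S = 𝔪_S^n`. OURS. (folklore) -/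
def IsHatOf {S T : Type} [CommRing S] [IsLocalRing S] [CommRing T] [IsLocalRing T] (ι : S →+* T) : Prop :=
  IsNoetherianRing T ∧ IsAdicComplete (maximalIdeal T) T ∧ (maximalIdeal S).map ι = maximalIdeal T ∧
    (∀ (n : ℕ) (t : T), ∃ a : S, t - ι a ∈ maximalIdeal T ^ n) ∧
    (∀ (n : ℕ) (a : S), ι a ∈ maximalIdeal T ^ n → a ∈ maximalIdeal S ^ n)

/-- VERBATIM (leaf §5♯, K-β6′ R-K7 guarded form = binder hβ6′ of `hK4_of_betaHat`). See the leaf docstring for the informal statement, the K7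
even-`d` counterexample and the paper proof (memo §12). OURS. (folklore) -/
def FormalCentreDescent : Prop :=
  ∀ (K : Type) [Field K] [CharP K 2] (R : ℕ → Subring K) (s : ℕ → K) (i : ℕ)
    (hloc : IsLocalRing (R i)) (hs : s i ^ 2 ∈ R i)
    (T : Type) [CommRing T] [IsLocalRing T] (ι : R i →+* T)
    (x y z w g : R i) (Ψ : MvPolynomial (Fin 2) (R i)) (d : ℕ) (z' w' q : T),
    IsRegularLocalRing (R i) → ringKrullDim (R i) = 4 → IsExcellentRing (R i) → IsHatOf ι → NoSingularSurfaceAt R s 2 i →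
    Ideal.span {x, y, z, w} = maximalIdeal (R i) → 2 ≤ d → Odd d → Ψ.IsHomogeneous d →
    (⟨s i ^ 2, hs⟩ : R i) - g ^ 2 - MvPolynomial.eval ![z, w] Ψ ∈ maximalIdeal (R i) ^ (d + 1) →
    (∀ a b : ResidueField (R i), (a ≠ 0 ∨ b ≠ 0) →
      MvPolynomial.eval ![a, b] (MvPolynomial.map (residue (R i)) Ψ) ≠ 0) →
    z' - ι z ∈ (Ideal.span {x, y}).map ι → w' - ι w ∈ (Ideal.span {x, y}).map ι →
    ι ⟨s i ^ 2, hs⟩ + q ^ 2 ∈ Ideal.span {ι x, z', w'} ^ d →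
    ∃ z'' w'' : R i, z'' - z ∈ Ideal.span {x, y} ∧ w'' - w ∈ Ideal.span {x, y} ∧
      Ideal.span {ι x, z', w'} = (Ideal.span {x, z'', w''}).map ι

/-! ## §F The frame and the coordinates (support words) -/

/-- **F0 · HatFrame** (support, size S/M; provers' shared first move). An `IsHatOf`-presentation `ι : S →+* T` of a local ring `S` is
ISOMORPHIC OVER `S` to Mathlib's `AdicCompletion (maximalIdeal S) S`: the maps `S ⧸ 𝔪_Sⁿ → T ⧸ 𝔪_Tⁿ` are injective (contraction clause) and
surjective (density clause + `𝔪_S T = 𝔪_T`), hence isomorphisms, compatibly in `n`; `T` is `𝔪_T`-adically complete and separated, so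
`T ≅ lim T ⧸ 𝔪_Tⁿ ≅ lim S ⧸ 𝔪_Sⁿ = Ŝ` (Mathlib `AdicCompletion.liftRingHom` builds `T →+* Ŝ` from the compatible family `T →+* S ⧸ 𝔪_Sⁿ`;
bijectivity from the two clauses). This is what lets every piece below invoke the tree's `AdicCompletion`-phrased theorems (RULING 214(d), FACT MAP)
BY NAME. OURS. (folklore) -/
def HatFrame : Prop :=
  ∀ (S T : Type) [CommRing S] [IsLocalRing S] [CommRing T] [IsLocalRing T] (ι : S →+* T),
    IsHatOf ι →
    ∃ e : T ≃+* AdicCompletion (maximalIdeal S) S,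
      ∀ a : S, e (ι a) = algebraMap S (AdicCompletion (maximalIdeal S) S) a

/-- **S0 · HatCoordinates** (support, size S/M; NOT a hypothesis of the assembly — a lemma every piece's prover will want, stated once so it is
proved once). For a regular local `S` of dimension `4` with r.s.o.p. `(x, y, z, w)` and a hat `ι : S →+* T`, and formal coordinates
`z′ ≡ ι z`, `w′ ≡ ι w (mod (x, y)T)`: `T` is regular local of dimension `4` (`isRegularLocalRing_adicCompletion` along the frame), `(ι x, ι y, z′, w′)`
is an r.s.o.p. of `T` (unimodular change of generators of `𝔪_S T = 𝔪_T`), and `P₁ := (ι x, z′, w′)` is a prime with `T ⧸ P₁` regular local of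
dimension `1` (quotient of a regular local ring by part of an r.s.o.p.; Mathlib `RegularLocalRing` API / tree `RsopMonomialIdeals`). OURS. (folklore) -/
def HatCoordinates : Prop :=
  ∀ (S T : Type) [CommRing S] [IsLocalRing S] [CommRing T] [IsLocalRing T] (ι : S →+* T)
    (e : T ≃+* AdicCompletion (maximalIdeal S) S) (x y z w : S) (z' w' : T),
    IsRegularLocalRing S → ringKrullDim S = 4 → IsHatOf ι →
    (∀ a : S, e (ι a) = algebraMap S (AdicCompletion (maximalIdeal S) S) a) →
    Ideal.span {x, y, z, w} = maximalIdeal S →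
    z' - ι z ∈ (Ideal.span {x, y}).map ι → w' - ι w ∈ (Ideal.span {x, y}).map ι →
    IsRegularLocalRing T ∧ ringKrullDim T = 4 ∧ Ideal.span {ι x, ι y, z', w'} = maximalIdeal T ∧
      (Ideal.span {ι x, z', w'}).IsPrime ∧ IsRegularLocalRing (T ⧸ Ideal.span {ι x, z', w'}) ∧
      ringKrullDim (T ⧸ Ideal.span {ι x, z', w'}) = 1

/-! ## §W The three crux pieces

Notation used in the docstrings (spelled out in the signatures): `F := ⟨s i ^ 2, hs⟩ : R i` (the radicand), `P₁ := Ideal.span {ι x, z′, w′} : Ideal T`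
(the formal centre, a height-3 prime by S0), `Q₀ := P₁.comap ι : Ideal (R i)` (its algebraic trace), `Q₀T := Ideal.map ι Q₀` (the formal
completion of the curve `Q₀`; its minimal primes are the FORMAL BRANCHES of `Q₀`). -/

/-- **W1 · BranchTransfer** (crux piece, memo §12.3 (1)+(2) / §12.5 (a)(b)(c)(g); size M/L — the excellent-rings bookkeeping). HYPOTHESES: the frame,
`R i` regular excellent of dimension `4`, no singular surface, `d ≥ 2`, the formal centre data and `ι F + q² ∈ P₁^d`. CONCLUSIONS, with `Q₀ := P₁ ∩ R i`:
(i) `Q₀T` is RADICAL — `T ⧸ Q₀T ≅ (R i ⧸ Q₀)^` is reduced because `R i ⧸ Q₀` is an excellent local domain (`IsGRing.isRadical_map_adicCompletion`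
transported along `e`); (ii) `P₁` is a MINIMAL prime of `Q₀T` — `Q₀` is a SINGULAR prime of `F` (if `(R i)_Q₀[t]/(t² − F)` were regular, so would be
its flat base change with regular closed fibre `T_P₁[t]/(t² − F)` (CRT 23.7 (ii)), but `t² − F = (t − q)² − (F + q²) ∈ 𝔑²` there since `d ≥ 2`,
cf. `isSingPrime_of_add_sq_mem_sq`), so `dim (R i ⧸ Q₀) ≤ 1` (`NoSingularSurfaceAt`), i.e. `ht Q₀ ≥ 3`; a minimal prime `𝔔 ⊆ P₁` of `Q₀T`
contracts to `Q₀` (going down, `under_eq_of_mem_minimalPrimes_map`) and has `ht 𝔔 = ht Q₀ + 0` (CRT 15.1, `ringKrullDim_eq_add_of_flat`), so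
`ht 𝔔 ≥ 3 = ht P₁` and `𝔔 = P₁`; (iii) EVERY minimal prime `𝔓` of `Q₀T` contracts to `Q₀` (going down again) and has `dim T ⧸ 𝔓 = 1`
(`≤ dim T ⧸ Q₀T = dim R i ⧸ Q₀ = 1`, and `𝔓 ≠ 𝔪_T` because an element `t ∈ 𝔪 ∖ Q₀` is a non-zero-divisor on `R i ⧸ Q₀`, hence on the flat
`T ⧸ Q₀T`, hence outside every minimal prime); (iv) the SQUARE-DESCENT DATUM: along the flat local map `(R i)_Q₀ → T_P₁` (`Q₀ T_P₁ = P₁ T_P₁` by (i)+(ii); its residue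
extension `κ(Q₀) → κ(P₁)` is SQUARE-CLOSED — an element of `κ(P₁)` whose square lies in `κ(Q₀)` lies in `κ(Q₀)` — because `κ(P₁) = T_P₁ ⧸ Q₀T_P₁` is a
local ring of the formal fibre over `Q₀`, geometrically regular (`IsGRing.isRegularHom_adicCompletion`, FACT MAP row (S)): `κ(P₁) ⊗ κ(Q₀)(√a)` is
reduced, which fails if `√a ∈ κ(P₁) ∖ κ(Q₀)`) the hypothesis «`F` is a square mod `P₁^d T_P₁`» descends by `SquareDescent.squareDescent_holds`
(p551383) to «`F` is a square mod `Q₀^d (R i)_Q₀`», which after clearing denominators and multiplying by a unit square reads `u² F + r² ∈ Q₀^d` with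
`u ∉ Q₀` (characteristic `2`).
WHY IT MIGHT FAIL: only through a mis-typed clause — each of (i)–(iv) is standard excellent-ring algebra [Matsumura1987 §§15, 23, 32; EGA IV₂ 7.8.3];
the K7 even-`d` witness satisfies (i)–(iv) (it is W2 that needs `Odd d`). OURS. (folklore) -/
def BranchTransfer : Prop :=
  ∀ (K : Type) [Field K] [CharP K 2] (R : ℕ → Subring K) (s : ℕ → K) (i : ℕ)
    (hloc : IsLocalRing (R i)) (hs : s i ^ 2 ∈ R i)
    (T : Type) [CommRing T] [IsLocalRing T] (ι : R i →+* T)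
    (e : T ≃+* AdicCompletion (maximalIdeal (R i)) (R i))
    (x y z w : R i) (d : ℕ) (z' w' q : T),
    IsRegularLocalRing (R i) → ringKrullDim (R i) = 4 → IsExcellentRing (R i) → IsHatOf ι →
    (∀ a : R i, e (ι a) = algebraMap (R i) (AdicCompletion (maximalIdeal (R i)) (R i)) a) →
    NoSingularSurfaceAt R s 2 i →
    Ideal.span {x, y, z, w} = maximalIdeal (R i) → 2 ≤ d →
    z' - ι z ∈ (Ideal.span {x, y}).map ι → w' - ι w ∈ (Ideal.span {x, y}).map ι →
    ι ⟨s i ^ 2, hs⟩ + q ^ 2 ∈ Ideal.span {ι x, z', w'} ^ d →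
    (Ideal.map ι ((Ideal.span {ι x, z', w'}).comap ι)).IsRadical ∧
    Ideal.span {ι x, z', w'} ∈ (Ideal.map ι ((Ideal.span {ι x, z', w'}).comap ι)).minimalPrimes ∧
    (∀ P ∈ (Ideal.map ι ((Ideal.span {ι x, z', w'}).comap ι)).minimalPrimes,
      P.comap ι = (Ideal.span {ι x, z', w'}).comap ι ∧ ringKrullDim (T ⧸ P) = 1) ∧
    ∃ u r : R i, u ∉ (Ideal.span {ι x, z', w'}).comap ι ∧
      u ^ 2 * (⟨s i ^ 2, hs⟩ : R i) + r ^ 2 ∈ (Ideal.span {ι x, z', w'}).comap ι ^ d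

/-- **W2 · BranchObstruction** (crux piece — THE HEART; memo §12.3 (3)+(4), §12.4, §11 sublemma / §12.5 (d)(e)(f); size L). In Cohen coordinates
`T ≅ κ⟦x, y, z̃, w̃⟧` adapted to `P₁ = (x, z̃, w̃)` (RULING 214(d): `exists_ringEquiv_mvPowerSeries_residueField` / `comp_map_bijective` with the r.s.o.p.
`(ι x, ι y, z′, w′)` of S0 and a coefficient field `exists_ringHom_comp_residue_eq_id_of_subring` — `κ` ARBITRARY of characteristic `2`), work in
`B := T ⧸ (ι x) ≅ κ⟦y, z̃, w̃⟧` with its continuous `κ⟦y⟧`-derivations `∂_z̃, ∂_w̃` (they kill squares): (3) from `ι F + q² ∈ P₁^d`, the normal form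
`F ≡ g² + Ψ(z, w) (mod 𝔪^{d+1})` and `d` odd, the image `Ḡ` of `F` in `B` has `∂_z̃ Ḡ, ∂_w̃ Ḡ ∈ 𝔭₁^{d−1}` (`𝔭₁ = (z̃, w̃)`, a prime generated by
variables, whose symbolic powers are its powers) with degree-`(d−1)` leading forms `Ψ̄_Z(z̃, w̃)`, `Ψ̄_W(z̃, w̃)` up to unit factors from `κ⟦y⟧`;
(4) let `𝔓 ∋ ι x` be a prime of `T` with `𝔓 ∩ R i = Q₀`, `dim T ⧸ 𝔓 = 1` and `𝔓 ⊇ Q₀T`; then `ι u ∉ 𝔓` and `ι(u² F + r²) ∈ 𝔓^d`, so `F` is a square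
mod `𝔓^d T_𝔓` and `∂_z̃ Ḡ, ∂_w̃ Ḡ ∈ 𝔭^{(d−1)}` for the height-2 prime `𝔭 = 𝔓 B` of `B`; parametrise the branch, `B ⧸ 𝔭 ↪ κ′⟦τ⟧`,
`y = τ^e·(unit)`, `z̃ = ζ(τ)`, `w̃ = ω(τ)` with `ord_τ (ζ, ω) =: m`, `1 ≤ m < ∞`, `1 ≤ e < ∞` (as `𝔭 ≠ 𝔭₁` and `𝔭 ∌ y` — the latter from
`𝔓 ∩ R i = Q₀ ∌ y`); the symbolic-power calculus of the Hasse derivations `Δ` in `(z̃, w̃)` (`Δ_k 𝔭^{(n)} ⊆ 𝔭^{(n−k)}`) gives `Δ_k ∂Ḡ ∈ 𝔭` for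
`|k| ≤ d − 2`, i.e. `(Δ_k ∂Ḡ)(τ^e·unit, ζ, ω) = 0` in `κ′⟦τ⟧`; the `𝔪_B`-degree-`(d−1)` component of `∂_z̃ Ḡ` is EXACTLY `Ψ̄_Z(z̃, w̃)` (by (3) and
`∂Ḡ ∈ 𝔭₁^{d−1}`), every monomial of `∂Ḡ` has `(z̃, w̃)`-degree `≥ d − 1`, so the error terms have `τ`-order `≥ (d−1−|k|)·m + min(e, m)` and the
`τ^{(d−1−|k|)m}`-coefficient reads `(Δ_k Ψ̄_Z)(ζ_m, ω_m) = 0` over `κ′` for all `|k| ≤ d − 2` (only the RESIDUES in `κ′` of the coefficients of `Ψ̄`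
enter, so no `κ`-compatible coefficient field of `κ′⟦τ⟧` is needed — important for imperfect `κ`); by Hasse–Taylor, `Ψ̄_Z` and `Ψ̄_W` are TRANSLATION
INVARIANT by the non-zero tangent vector `(ζ_m, ω_m) ∈ κ′²`; by `eq_C_mul_linearPow_of_translation_invariant` (p550845) both are `κ′`-multiples of
`ℓ^{d−1}`, `ℓ = ω_m Z − ζ_m W`, and Euler's identity for odd `d` in characteristic `2` (`Ψ = Z Ψ_Z + W Ψ_W`) gives `Ψ̄ = ℓ^{d−1}·(αZ + βW)` over `κ′` —
contradicting `oddAnisotropicNoAlmostPower_holds` (p551405: an anisotropic binary form of odd degree `d ≥ 3` over `κ` is not `ℓ^{d−1}·m` over ANY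
extension `κ′`, `m = 0` included). Hence `𝔓 = P₁`. The piece is stated for `𝔓 ∈ (Q₀T).minimalPrimes` with the two W1-facts `𝔓 ∩ R i = Q₀`, `dim T ⧸ 𝔓 = 1` and the
W1-datum `(u, r)` as hypotheses; it needs neither excellence nor `NoSingularSurfaceAt`.
(3) in detail: `∂_z̃ Ḡ ≡ Ψ̄_Z(L₁, L₂)·∂_z̃ L₁ + Ψ̄_W(L₁, L₂)·∂_z̃ L₂ (mod 𝔪_B^d)` with `L₁ = z̃ + yβ`, `L₂ = w̃ + yγ` the images of `z, w` (H_z, H_w),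
`∂_z̃ L₁ ≡ 1`, `y ∣ ∂_z̃ L₂` (derivatives of the images of the coefficients of `Ψ` and of `m ∈ 𝔪^{d+1}` only contribute in degree `≥ d`), so the
degree-`(d−1)` component is `Ψ̄_Z(z̃ + β₀y, w̃ + γ₀y)`, which lies in `κ[z̃, w̃]` because `∂Ḡ ∈ 𝔭₁^{d−1}` — hence equals `Ψ̄_Z(z̃, w̃)`.
WHY IT MIGHT FAIL: the order bookkeeping in (4) (symbolic powers vs. `𝔪_B`-adic components along a branch tangent to `V(z̃, w̃)` to high order,
`m > e`) — the estimate `≥ (d−1−|k|)m + min(e, m)` above is where `∂Ḡ ∈ 𝔭₁^{d−1}` must be used a second time; `Odd d` is ESSENTIAL (K7: at `d = 2`,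
`Ψ = Z² + aW²` over `𝔽₂(a)` the second branch exists and Euler's identity degenerates). Branch parametrisation `B ⧸ 𝔭 ↪ κ′⟦τ⟧`: TREE theorem
`Literature.AlgebraicGeometry.Resolution.exists_branchParametrization_of_complete` (res-D-lit-1 p554060, (e-ring) brick T4). OURS (memo §12.3–§12.4). (folklore) -/
def BranchObstruction : Prop :=
  ∀ (K : Type) [Field K] [CharP K 2] (R : ℕ → Subring K) (s : ℕ → K) (i : ℕ)
    (hloc : IsLocalRing (R i)) (hs : s i ^ 2 ∈ R i)
    (T : Type) [CommRing T] [IsLocalRing T] (ι : R i →+* T)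
    (e : T ≃+* AdicCompletion (maximalIdeal (R i)) (R i))
    (x y z w g : R i) (Ψ : MvPolynomial (Fin 2) (R i)) (d : ℕ) (z' w' q : T) (u r : R i),
    IsRegularLocalRing (R i) → ringKrullDim (R i) = 4 → IsHatOf ι →
    (∀ a : R i, e (ι a) = algebraMap (R i) (AdicCompletion (maximalIdeal (R i)) (R i)) a) →
    Ideal.span {x, y, z, w} = maximalIdeal (R i) → 2 ≤ d → Odd d → Ψ.IsHomogeneous d →
    (⟨s i ^ 2, hs⟩ : R i) - g ^ 2 - MvPolynomial.eval ![z, w] Ψ ∈ maximalIdeal (R i) ^ (d + 1) →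
    (∀ a b : ResidueField (R i), (a ≠ 0 ∨ b ≠ 0) →
      MvPolynomial.eval ![a, b] (MvPolynomial.map (residue (R i)) Ψ) ≠ 0) →
    z' - ι z ∈ (Ideal.span {x, y}).map ι → w' - ι w ∈ (Ideal.span {x, y}).map ι →
    ι ⟨s i ^ 2, hs⟩ + q ^ 2 ∈ Ideal.span {ι x, z', w'} ^ d →
    u ∉ (Ideal.span {ι x, z', w'}).comap ι →
    u ^ 2 * (⟨s i ^ 2, hs⟩ : R i) + r ^ 2 ∈ (Ideal.span {ι x, z', w'}).comap ι ^ d →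
    ∀ P ∈ (Ideal.map ι ((Ideal.span {ι x, z', w'}).comap ι)).minimalPrimes,
      P.comap ι = (Ideal.span {ι x, z', w'}).comap ι → ringKrullDim (T ⧸ P) = 1 →
      P = Ideal.span {ι x, z', w'}

/-- **W3 · BranchConclusion** (crux piece, memo §12.3 (5) / §12.5 (a); size S/M). If the formal completion of the algebraic trace is the formal
centre itself, `Q₀T = P₁` (`Q₀ := P₁ ∩ R i`), then: `dim R i ⧸ Q₀ = dim T ⧸ Q₀T = dim T ⧸ P₁ = 1` (flat local with `𝔪`-primary fibre, or
`(R i ⧸ Q₀)^ ≅ T ⧸ Q₀T`; `ringKrullDim_eq_of_flat_of_map_maximalIdeal_eq`), so `ht Q₀ = 3` (`R i` regular of dimension `4`); faithful flatness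
(`IT ∩ R i = I`, from the `IsHatOf` clauses / `Module.FaithfullyFlat`) applied to `Q₀T + (x, y)T = P₁ + (ι x, ι y) = 𝔪_T = 𝔪T` (S0) gives
`Q₀ + (x, y) = 𝔪`, so `z = z″ + a x + b y`, `w = w″ + a′ x + b′ y` with `z″, w″ ∈ Q₀`; the classes of `x, z″, w″, y` span `𝔪/𝔪²`, so `(x, z″, w″, y)`
is an r.s.o.p., `(x, z″, w″)` is a prime of height `3` inside `Q₀`, hence `= Q₀`, and `P₁ = Q₀T = (x, z″, w″)T`. (Regularity of `R i ⧸ Q₀` —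
memo (5) — drops out; no descent theorem is needed.) No characteristic, parity, excellence or cone hypothesis is used.
WHY IT MIGHT FAIL: only through a mis-typed clause; mathematically routine (`RsopMonomialIdeals`-style bookkeeping). OURS. (folklore) -/
def BranchConclusion : Prop :=
  ∀ (K : Type) [Field K] (R : ℕ → Subring K) (i : ℕ) (hloc : IsLocalRing (R i))
    (T : Type) [CommRing T] [IsLocalRing T] (ι : R i →+* T)
    (e : T ≃+* AdicCompletion (maximalIdeal (R i)) (R i))
    (x y z w : R i) (z' w' : T),
    IsRegularLocalRing (R i) → ringKrullDim (R i) = 4 → IsHatOf ι →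
    (∀ a : R i, e (ι a) = algebraMap (R i) (AdicCompletion (maximalIdeal (R i)) (R i)) a) →
    Ideal.span {x, y, z, w} = maximalIdeal (R i) →
    z' - ι z ∈ (Ideal.span {x, y}).map ι → w' - ι w ∈ (Ideal.span {x, y}).map ι →
    Ideal.map ι ((Ideal.span {ι x, z', w'}).comap ι) = Ideal.span {ι x, z', w'} →
    ∃ z'' w'' : R i, z'' - z ∈ Ideal.span {x, y} ∧ w'' - w ∈ Ideal.span {x, y} ∧
      Ideal.span {ι x, z', w'} = (Ideal.span {x, z'', w''}).map ι

/-! ## §A The assembly (kernel-checked, no `sorry`) -/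

/-- **K-β7-hat ASSEMBLY.** `FormalCentreDescent` follows from the frame F0 and the pieces W1, W2, W3 by pure logic plus «a radical ideal whose only
minimal prime is `P₁` equals `P₁`» (`Ideal.IsRadical.radical`, `Ideal.sInf_minimalPrimes`, `sInf_singleton`). OURS. -/
theorem formalCentreDescent_of (hF : HatFrame) (hT : BranchTransfer) (hO : BranchObstruction)
    (hC : BranchConclusion) : FormalCentreDescent := by
  intro K _ _ R s i hloc hs T _ _ ι x y z w g Ψ d z' w' q hreg hdim hexc hhat hnss hspan h2 hodd hhom hnf han hz hw hsq
  obtain ⟨e, he⟩ := hF (R i) T ι hhat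
  obtain ⟨hrad, hP1, hbr, u, r, hu, hur⟩ :=
    hT K R s i hloc hs T ι e x y z w d z' w' q hreg hdim hexc hhat he hnss hspan h2 hz hw hsq
  have huniq : ∀ P ∈ (Ideal.map ι ((Ideal.span {ι x, z', w'}).comap ι)).minimalPrimes,
      P = Ideal.span {ι x, z', w'} := fun P hP =>
    hO K R s i hloc hs T ι e x y z w g Ψ d z' w' q u r hreg hdim hhat he hspan h2 hodd hhom hnf han hz hw hsq
      hu hur P hP (hbr P hP).1 (hbr P hP).2
  have hJ : Ideal.map ι ((Ideal.span {ι x, z', w'}).comap ι) = Ideal.span {ι x, z', w'} := by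
    have hmin : (Ideal.map ι ((Ideal.span {ι x, z', w'}).comap ι)).minimalPrimes =
        {Ideal.span {ι x, z', w'}} := by
      ext P
      simp only [Set.mem_singleton_iff]
      exact ⟨fun h => huniq P h, fun h => h ▸ hP1⟩
    conv_lhs => rw [← hrad.radical, ← Ideal.sInf_minimalPrimes, hmin, sInf_singleton]
  exact hC K R i hloc T ι e x y z w z' w' hreg hdim hhat he hspan hz hw hJ

/-! ## §B Shape checks (kernel-checked): the pieces are USED, and the two W1-facts handed to W2 are exactly W2's last binders -/

/-- The W1 → W2 hand-over typechecks clause by clause (documentation of the interface; trivial). OURS. -/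
theorem branch_handover_shape (hT : BranchTransfer) (hO : BranchObstruction)
    (K : Type) [Field K] [CharP K 2] (R : ℕ → Subring K) (s : ℕ → K) (i : ℕ)
    (hloc : IsLocalRing (R i)) (hs : s i ^ 2 ∈ R i)
    (T : Type) [CommRing T] [IsLocalRing T] (ι : R i →+* T)
    (e : T ≃+* AdicCompletion (maximalIdeal (R i)) (R i))
    (x y z w g : R i) (Ψ : MvPolynomial (Fin 2) (R i)) (d : ℕ) (z' w' q : T)
    (hreg : IsRegularLocalRing (R i)) (hdim : ringKrullDim (R i) = 4) (hexc : IsExcellentRing (R i)) (hhat : IsHatOf ι)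
    (he : ∀ a : R i, e (ι a) = algebraMap (R i) (AdicCompletion (maximalIdeal (R i)) (R i)) a)
    (hnss : NoSingularSurfaceAt R s 2 i) (hspan : Ideal.span {x, y, z, w} = maximalIdeal (R i)) (h2 : 2 ≤ d) (hodd : Odd d)
    (hhom : Ψ.IsHomogeneous d)
    (hnf : (⟨s i ^ 2, hs⟩ : R i) - g ^ 2 - MvPolynomial.eval ![z, w] Ψ ∈ maximalIdeal (R i) ^ (d + 1))
    (han : ∀ a b : ResidueField (R i), (a ≠ 0 ∨ b ≠ 0) → MvPolynomial.eval ![a, b] (MvPolynomial.map (residue (R i)) Ψ) ≠ 0)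
    (hz : z' - ι z ∈ (Ideal.span {x, y}).map ι) (hw : w' - ι w ∈ (Ideal.span {x, y}).map ι)
    (hsq : ι ⟨s i ^ 2, hs⟩ + q ^ 2 ∈ Ideal.span {ι x, z', w'} ^ d) :
    (Ideal.map ι ((Ideal.span {ι x, z', w'}).comap ι)).minimalPrimes ⊆ {Ideal.span {ι x, z', w'}} := by
  obtain ⟨-, -, hbr, u, r, hu, hur⟩ :=
    hT K R s i hloc hs T ι e x y z w d z' w' q hreg hdim hexc hhat he hnss hspan h2 hz hw hsq
  intro P hP
  exact hO K R s i hloc hs T ι e x y z w g Ψ d z' w' q u r hreg hdim hhat he hspan h2 hodd hhom hnf han hz hw hsq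
    hu hur P hP (hbr P hP).1 (hbr P hP).2

end Summit.ResolutionOfSingularities.ResolutionOfSingularities.Theorems.SwitchingDichotomy.K7Hat
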